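import Mathlib.Analysis.Fourier.PoissonSummation
import Mathlib.Analysis.PSeries
import Literature.Analysis.Fourier.WeightedStationaryPhase
import Literature.NumberTheory.LFunctions.VanDerCorputZeta
import Literature.NumberTheory.LFunctions.VanDerCorputBProcess
import HarnessLib

/-!
# The weighted van der Corput `B`-process: Poisson summation with a smooth amplitude followed by
# sharp stationary phase

Topic `Literature/NumberTheory/LFunctions`.  Everything here is PROVED; the only definitions are the
hypothesis structure `VdC.WeightedBHyp` and the explicit tail constant `VdC.bTail`.

Let `g` be a real amplitude with two derivatives on `[α, β]`, vanishing outside `(α, β)`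
(`|g| ≤ G`, `|g'| ≤ G₁`, `|g''| ≤ G₂`), and `p` a real phase with three derivatives on `[α, β]`,
`r ≤ p'' ≤ Ar` (`r > 0`, `A ≥ 1`), `|p'''| ≤ λ₃`.  Then (`VdC.weightedBProcess`)

  `∑_{n ∈ ℤ} g(n) e(p(n)) = 𝔣 ∑_{p'(α) < ν < p'(β)} g(x_ν) e(p(x_ν) - ν x_ν) (2π p''(x_ν))^{-1/2} + O(Err)`,

where `p'(x_ν) = ν` (the stationary points, supplied as data), `𝔣 = fresnelC = ∫ e^{iu²/2} du`
(`= (2π)^{1/2} e^{iπ/4}`, value not needed), and, with `L = log(1 + (β - α)(2πr)^{1/2})`,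

  `Err = (Ar(β - α) + 1) E₁ + 2 E₂ + 4 T`,
  `E₁ = G · 2A³ (λ₃/(2π r²)) (2 + 2L) + (G₁/(2πr)) (10 + 4AL)`   (one stationary frequency),
  `E₂ = (G₁/(2πr)) (3 + (1 + A) L)`                               (a frequency stationary at an end-point),
  `T = bTail … (2π)`                                              (all the other frequencies).

Proof: Poisson summation on `ℝ` (Mathlib's `Real.tsum_eq_tsum_fourier_of_rpow_decay_of_summable`; the
summand `g(x)e(p(x))` is continuous and compactly supported) gives `∑_n g(n)e(p(n)) = ∑_ν I(ν)`,
`I(ν) = ∫_α^β g(x) e(p(x) - νx) dx`; each `I(ν)` is treated by `weightedStationaryPhase_sharp`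
(`p'(α) < ν < p'(β)`), `norm_integral_amp_right_le`/`_left_le` (`ν = ⌊p'(α)⌋`, `⌈p'(β)⌉`) or the tail
estimate `norm_integral_amp_le_of_deriv_ge` (`|p' - ν| ≥ j ≥ 1`, summed with `∑ j⁻² ≤ 2`), all from
`Literature/Analysis/Fourier/WeightedStationaryPhase.lean`.

## References

* E. C. Titchmarsh, *The Theory of the Riemann Zeta-Function*, 2nd ed. (1986), Lemma 4.7 and Theorem 4.9
  (the unweighted `B`-process). [Titchmarsh1986]
* S. W. Graham, G. Kolesnik, *Van der Corput's Method of Exponential Sums*, LMS LN 126 (1991), Lemma 3.6.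
  [GrahamKolesnik1991]
* M. N. Huxley, *Area, Lattice Points, and Exponential Sums*, OUP 1996, §5.4 (the weighted form). [Huxley1996]
-/

noncomputable section

open Finset Real MeasureTheory Set Complex Filter Topology
open scoped FourierTransform

namespace Literature.NumberTheory.LFunctions
namespace VdC

open Literature.Analysis.Fourier

local notation "𝔣C" => _root_.Literature.Analysis.Fourier.fresnelC

/-! ### The hypotheses -/

/-- Hypotheses of the weighted `B`-process on `[α, β]`: a phase `p` with three derivatives,
`r ≤ p'' ≤ Ar`, `|p'''| ≤ λ₃`; an amplitude `g` with two derivatives, `|g| ≤ G`, `|g'| ≤ G₁`,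
`|g''| ≤ G₂`, vanishing outside `(α, β)`; and continuity of the summand `g · e(p)` on `ℝ`. [folklore] -/
structure WeightedBHyp (g g' g'' p p' p'' p''' : ℝ → ℝ) (α β r A lam3 G G₁ G₂ : ℝ) : Prop where
  hαβ : α < β
  hr : 0 < r
  hA : 1 ≤ A
  hp : ∀ x ∈ Icc α β, HasDerivAt p (p' x) x
  hp' : ∀ x ∈ Icc α β, HasDerivAt p' (p'' x) x
  hp'' : ∀ x ∈ Icc α β, HasDerivAt p'' (p''' x) x
  hp'''c : ContinuousOn p''' (Icc α β)
  h2 : ∀ x ∈ Icc α β, r ≤ p'' x ∧ p'' x ≤ A * r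
  h3 : ∀ x ∈ Icc α β, |p''' x| ≤ lam3
  hg : ∀ x ∈ Icc α β, HasDerivAt g (g' x) x
  hg' : ∀ x ∈ Icc α β, HasDerivAt g' (g'' x) x
  hg''c : ContinuousOn g'' (Icc α β)
  hGb : ∀ x ∈ Icc α β, |g x| ≤ G
  hG1b : ∀ x ∈ Icc α β, |g' x| ≤ G₁
  hG2b : ∀ x ∈ Icc α β, |g'' x| ≤ G₂
  hg0 : ∀ x, x ∉ Ioo α β → g x = 0
  hcont : Continuous fun x => (g x : ℂ) * e (p x)

/-- The tail constant `T(D) = 2(G₁/D² + G B₂/D³) + (β-α)(G₂/D² + 3G₁B₂/D³ + G B₃/D³ + 3G B₂²/D⁴)` of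
`norm_integral_amp_le_of_deriv_ge`, with `B₂ = 2πAr`, `B₃ = 2πλ₃`. [folklore] -/
def bTail (α β r A lam3 G G₁ G₂ D : ℝ) : ℝ :=
  2 * (G₁ / D ^ 2 + G * (2 * π * A * r) / D ^ 3)
    + (β - α) * (G₂ / D ^ 2 + 3 * G₁ * (2 * π * A * r) / D ^ 3 + G * (2 * π * lam3) / D ^ 3
      + 3 * G * (2 * π * A * r) ^ 2 / D ^ 4)

/-- The summand `g(x) e(p(x) - νx)` as `g · e^{iP_ν}`, `P_ν = 2π(p - ν·)`. [folklore] -/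
theorem summand_eq_exp (g p : ℝ → ℝ) (ν x : ℝ) :
    (g x : ℂ) * e (p x - ν * x) = (g x : ℂ) * Complex.exp (I * ((2 * π * (p x - ν * x) : ℝ) : ℂ)) := by
  rw [e_eq_exp_I_mul]

namespace WeightedBHyp

variable {g g' g'' p p' p'' p''' : ℝ → ℝ} {α β r A lam3 G G₁ G₂ : ℝ}
  (H : WeightedBHyp g g' g'' p p' p'' p''' α β r A lam3 G G₁ G₂)
include H

/-! ### Elementary consequences -/

/-- `α ≤ β`. [folklore] -/
theorem hαβ' : α ≤ β := H.hαβ.le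

/-- `α ∈ [α, β]`. [folklore] -/
theorem αmem : α ∈ Icc α β := left_mem_Icc.2 H.hαβ'

/-- `β ∈ [α, β]`. [folklore] -/
theorem βmem : β ∈ Icc α β := right_mem_Icc.2 H.hαβ'

/-- `λ₃ ≥ 0`. [folklore] -/
theorem lam3_nonneg : 0 ≤ lam3 := (abs_nonneg _).trans (H.h3 α H.αmem)

/-- `G ≥ 0`. [folklore] -/
theorem G_nonneg : 0 ≤ G := (abs_nonneg _).trans (H.hGb α H.αmem)

/-- `G₁ ≥ 0`. [folklore] -/
theorem G1_nonneg : 0 ≤ G₁ := (abs_nonneg _).trans (H.hG1b α H.αmem)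

/-- `G₂ ≥ 0`. [folklore] -/
theorem G2_nonneg : 0 ≤ G₂ := (abs_nonneg _).trans (H.hG2b α H.αmem)

/-- `g(α) = 0`. [folklore] -/
theorem gα : g α = 0 := H.hg0 α fun h => lt_irrefl _ h.1

/-- `g(β) = 0`. [folklore] -/
theorem gβ : g β = 0 := H.hg0 β fun h => lt_irrefl _ h.2

/-- `p'` is continuous on `[α, β]`. [folklore] -/
theorem continuousOn_p' : ContinuousOn p' (Icc α β) := fun x hx => (H.hp' x hx).continuousAt.continuousWithinAt

/-- `p''` is continuous on `[α, β]`. [folklore] -/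
theorem continuousOn_p'' : ContinuousOn p'' (Icc α β) := fun x hx => (H.hp'' x hx).continuousAt.continuousWithinAt

/-- `g'` is continuous on `[α, β]`. [folklore] -/
theorem continuousOn_g' : ContinuousOn g' (Icc α β) := fun x hx => (H.hg' x hx).continuousAt.continuousWithinAt

/-- Growth of `p'`: `r(y - x) ≤ p'(y) - p'(x) ≤ Ar(y - x)` for `x ≤ y` in `[α, β]`. [folklore] -/
theorem p'_incr {x y : ℝ} (hx : x ∈ Icc α β) (hy : y ∈ Icc α β) (hxy : x ≤ y) :
    r * (y - x) ≤ p' y - p' x ∧ p' y - p' x ≤ A * r * (y - x) := by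
  rcases eq_or_lt_of_le hxy with h | h
  · subst h; simp
  have hsub : Icc x y ⊆ Icc α β := Icc_subset_Icc hx.1 hy.2
  obtain ⟨ξ, hξ, hξ'⟩ := exists_hasDerivAt_eq_sub h (fun z hz => H.hp' z (hsub hz))
  have hb := H.h2 ξ (hsub (Ioo_subset_Icc_self hξ))
  rw [hξ']
  exact ⟨mul_le_mul_of_nonneg_right hb.1 (by linarith), mul_le_mul_of_nonneg_right hb.2 (by linarith)⟩

/-- `p'(α) < p'(β)`. [folklore] -/
theorem p'α_lt_p'β : p' α < p' β := by
  have := (H.p'_incr H.αmem H.βmem H.hαβ').1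
  have : 0 < r * (β - α) := mul_pos H.hr (sub_pos.2 H.hαβ)
  linarith

/-! ### The phases `P_ν(x) = 2π(p(x) - νx)` and the Fourier integrals `I(ν)` -/

/-- The three derivatives of `P_ν = 2π(p - ν ·)`. [folklore] -/
theorem hasDerivAt_P (ν : ℝ) {x : ℝ} (hx : x ∈ Icc α β) :
    HasDerivAt (fun x => 2 * π * (p x - ν * x)) (2 * π * (p' x - ν)) x := by
  have := ((H.hp x hx).sub ((hasDerivAt_id x).const_mul ν)).const_mul (2 * π)
  exact this.congr_deriv (by simp)

/-- The derivative of `P_ν' = 2π(p' - ν)`. [folklore] -/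
theorem hasDerivAt_P' (ν : ℝ) {x : ℝ} (hx : x ∈ Icc α β) :
    HasDerivAt (fun x => 2 * π * (p' x - ν)) (2 * π * p'' x) x := by
  have := ((H.hp' x hx).sub_const ν).const_mul (2 * π)
  exact this.congr_deriv (by simp)

/-- The derivative of `P_ν'' = 2πp''`. [folklore] -/
theorem hasDerivAt_P'' {x : ℝ} (hx : x ∈ Icc α β) :
    HasDerivAt (fun x => 2 * π * p'' x) (2 * π * p''' x) x := (H.hp'' x hx).const_mul (2 * π)

/-- `2πr ≤ P_ν'' ≤ A(2πr)`. [folklore] -/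
theorem P''_bounds {x : ℝ} (hx : x ∈ Icc α β) :
    2 * π * r ≤ 2 * π * p'' x ∧ 2 * π * p'' x ≤ A * (2 * π * r) := by
  have := H.h2 x hx
  have hπ := Real.pi_pos
  constructor <;> nlinarith

/-- `|P_ν'''| ≤ 2πλ₃`. [folklore] -/
theorem P'''_bound {x : ℝ} (hx : x ∈ Icc α β) : |2 * π * p''' x| ≤ 2 * π * lam3 := by
  rw [abs_mul, abs_of_pos (by positivity)]
  exact mul_le_mul_of_nonneg_left (H.h3 x hx) (by positivity)

/-! ### The three estimates for `I(ν) = ∫_α^β g e(p - ν·)` -/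

/-- The logarithm `L = log(1 + (β - α)(2πr)^{1/2})` is nonnegative. [folklore] -/
theorem L_nonneg : 0 ≤ Real.log (1 + (β - α) * Real.sqrt (2 * π * r)) :=
  Real.log_nonneg (by nlinarith [Real.sqrt_nonneg (2 * π * r), sub_pos.2 H.hαβ])

/-- **A stationary frequency** `p'(α) < ν < p'(β)`, `p'(x_ν) = ν`, `x_ν ∈ (α, β)`:
`‖I(ν) - g(x_ν) 𝔣 e(p(x_ν) - νx_ν) (2πp''(x_ν))^{-1/2}‖ ≤ E₁`. [cite: GrahamKolesnik1991, Lemma 3.6] -/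
theorem stationary_bound {ν xν : ℝ} (hxν : xν ∈ Ioo α β) (hcrit : p' xν = ν) :
    ‖(∫ x in α..β, (g x : ℂ) * e (p x - ν * x))
        - (g xν : ℂ) * (𝔣C * e (p xν - ν * xν) * ((Real.sqrt (2 * π * p'' xν))⁻¹ : ℝ))‖
      ≤ G * (2 * A ^ 3 * (2 * π * lam3 / (2 * π * r) ^ 2) * (2 + 2 * Real.log (1 + (β - α) * Real.sqrt (2 * π * r))))
        + G₁ / (2 * π * r) * (10 + 4 * A * Real.log (1 + (β - α) * Real.sqrt (2 * π * r))) := by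
  set L := Real.log (1 + (β - α) * Real.sqrt (2 * π * r)) with hL
  have hπ := Real.pi_pos
  have hr2 : 0 < 2 * π * r := by have := H.hr; positivity
  have key := weightedStationaryPhase_sharp (P := fun x => 2 * π * (p x - ν * x)) (P' := fun x => 2 * π * (p' x - ν))
    (P'' := fun x => 2 * π * p'' x) (P''' := fun x => 2 * π * p''' x) (g := g) (g' := g') (g'' := g'')
    (α := α) (β := β) (c := xν) (r := 2 * π * r) (A := A) (lam3 := 2 * π * lam3) (G₁ := G₁)
    hxν.1 hxν.2 hr2 H.hA (fun x hx => H.hasDerivAt_P ν hx) (fun x hx => H.hasDerivAt_P' ν hx)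
    (fun x hx => H.hasDerivAt_P'' hx) (fun x hx => H.P''_bounds hx) (fun x hx => H.P'''_bound hx)
    (by simp [hcrit]) H.hg H.hg' H.hG1b H.gα H.gβ
  simp only [← summand_eq_exp g p] at key
  have hmain : (g xν : ℂ) * (𝔣C * e (p xν - ν * xν) * ((Real.sqrt (2 * π * p'' xν))⁻¹ : ℝ))
      = (g xν : ℂ) * (𝔣C * Complex.exp (I * ((2 * π * (p xν - ν * xν) : ℝ) : ℂ))
        * ((Real.sqrt (2 * π * p'' xν))⁻¹ : ℝ)) := by rw [e_eq_exp_I_mul]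
  rw [hmain]
  refine key.trans ?_
  -- simplify the logarithms and `|g(x_ν)| ≤ G`
  have hxI : xν ∈ Icc α β := Ioo_subset_Icc_self hxν
  have hsr : 0 ≤ Real.sqrt (2 * π * r) := Real.sqrt_nonneg _
  have hL1 : Real.log (1 + (xν - α) * Real.sqrt (2 * π * r)) ≤ L :=
    Real.log_le_log (by nlinarith [hxν.1]) (by nlinarith [hxν.2])
  have hL2 : Real.log (1 + (β - xν) * Real.sqrt (2 * π * r)) ≤ L :=
    Real.log_le_log (by nlinarith [hxν.2]) (by nlinarith [hxν.1])
  have hL10 : 0 ≤ Real.log (1 + (xν - α) * Real.sqrt (2 * π * r)) := Real.log_nonneg (by nlinarith [hxν.1])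
  have hL20 : 0 ≤ Real.log (1 + (β - xν) * Real.sqrt (2 * π * r)) := Real.log_nonneg (by nlinarith [hxν.2])
  have hgx : |g xν| ≤ G := H.hGb xν hxI
  have hA := (lt_of_lt_of_le one_pos H.hA)
  have hl := H.lam3_nonneg
  have hG1 := H.G1_nonneg
  have hc1 : 0 ≤ 2 * A ^ 3 * (2 * π * lam3 / (2 * π * r) ^ 2) := by positivity
  have hc2 : 0 ≤ G₁ / (2 * π * r) := by positivity
  have e1 : |g xν| * (2 * A ^ 3 * (2 * π * lam3 / (2 * π * r) ^ 2) *
        (2 + Real.log (1 + (xν - α) * Real.sqrt (2 * π * r)) + Real.log (1 + (β - xν) * Real.sqrt (2 * π * r))))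
      ≤ G * (2 * A ^ 3 * (2 * π * lam3 / (2 * π * r) ^ 2) * (2 + 2 * L)) := by
    refine mul_le_mul hgx ?_ (by positivity) H.G_nonneg
    exact mul_le_mul_of_nonneg_left (by linarith) hc1
  have e2 : G₁ / (2 * π * r) * (10 + 2 * A * (Real.log (1 + (xν - α) * Real.sqrt (2 * π * r))
        + Real.log (1 + (β - xν) * Real.sqrt (2 * π * r))))
      ≤ G₁ / (2 * π * r) * (10 + 4 * A * L) := by
    refine mul_le_mul_of_nonneg_left ?_ hc2
    nlinarith
  exact add_le_add e1 e2

/-- **The frequency `ν = ⌈p'(β)⌉`** (stationary point at or beyond `β`): `‖I(ν)‖ ≤ E₂`.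
[cite: GrahamKolesnik1991, Lemma 3.1] -/
theorem upper_near_bound {ν : ℝ} (hν : p' β ≤ ν) :
    ‖∫ x in α..β, (g x : ℂ) * e (p x - ν * x)‖
      ≤ G₁ / (2 * π * r) * (3 + (1 + A) * Real.log (1 + (β - α) * Real.sqrt (2 * π * r))) := by
  have hπ := Real.pi_pos
  have hr := H.hr
  have hr2 : 0 < 2 * π * r := by positivity
  simp only [summand_eq_exp g p]
  have key := norm_integral_amp_left_le (P := fun x => 2 * π * (p x - ν * x)) (P' := fun x => 2 * π * (p' x - ν))
    (P'' := fun x => 2 * π * p'' x) (k := g) (k' := g') (α := α) (c := β) (r := 2 * π * r) (B := A * (2 * π * r))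
    (K₁ := G₁) H.hαβ' hr2 (by have := (lt_of_lt_of_le one_pos H.hA); positivity) H.G1_nonneg
    (fun x hx => H.hasDerivAt_P ν hx) (fun x hx => H.hasDerivAt_P' ν hx)
    (continuousOn_const.mul H.continuousOn_p'')
    (fun x hx => by
      have := (H.p'_incr hx H.βmem hx.2).1
      nlinarith)
    (fun x hx => by
      rw [abs_of_pos (by have := (H.P''_bounds hx).1; linarith)]; exact (H.P''_bounds hx).2)
    H.hg H.continuousOn_g' H.hG1b H.gβ
  refine key.trans (le_of_eq ?_)
  rw [mul_div_assoc, div_self hr2.ne', mul_one]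

/-- **The frequency `ν = ⌊p'(α)⌋`** (stationary point at or before `α`): `‖I(ν)‖ ≤ E₂`.
[cite: GrahamKolesnik1991, Lemma 3.1] -/
theorem lower_near_bound {ν : ℝ} (hν : ν ≤ p' α) :
    ‖∫ x in α..β, (g x : ℂ) * e (p x - ν * x)‖
      ≤ G₁ / (2 * π * r) * (3 + (1 + A) * Real.log (1 + (β - α) * Real.sqrt (2 * π * r))) := by
  have hπ := Real.pi_pos
  have hr := H.hr
  have hr2 : 0 < 2 * π * r := by positivity
  simp only [summand_eq_exp g p]
  have key := norm_integral_amp_right_le (P := fun x => 2 * π * (p x - ν * x)) (P' := fun x => 2 * π * (p' x - ν))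
    (P'' := fun x => 2 * π * p'' x) (k := g) (k' := g') (c := α) (β := β) (r := 2 * π * r) (B := A * (2 * π * r))
    (K₁ := G₁) H.hαβ' hr2 (by have := (lt_of_lt_of_le one_pos H.hA); positivity) H.G1_nonneg
    (fun x hx => H.hasDerivAt_P ν hx) (fun x hx => H.hasDerivAt_P' ν hx)
    (continuousOn_const.mul H.continuousOn_p'')
    (fun x hx => by
      have := (H.p'_incr H.αmem hx hx.1).1
      nlinarith)
    (fun x hx => by
      rw [abs_of_pos (by have := (H.P''_bounds hx).1; linarith)]; exact (H.P''_bounds hx).2)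
    H.hg H.continuousOn_g' H.hG1b H.gα
  refine key.trans (le_of_eq ?_)
  rw [mul_div_assoc, div_self hr2.ne', mul_one]

/-- The tail constant is nonnegative for `D > 0`. [folklore] -/
theorem bTail_nonneg {D : ℝ} (hD : 0 < D) : 0 ≤ bTail α β r A lam3 G G₁ G₂ D := by
  have := H.G_nonneg; have := H.G1_nonneg; have := H.G2_nonneg; have := (lt_of_lt_of_le one_pos H.hA); have := H.hr
  have := H.lam3_nonneg; have := sub_pos.2 H.hαβ
  unfold bTail
  positivity

/-- Scaling of the tail constant: `T(2πj) ≤ T(2π)/j²` for `j ≥ 1`. [folklore] -/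
theorem bTail_le_div {j : ℝ} (hj : 1 ≤ j) :
    bTail α β r A lam3 G G₁ G₂ (2 * π * j) ≤ bTail α β r A lam3 G G₁ G₂ (2 * π) / j ^ 2 := by
  have hG := H.G_nonneg; have hG1 := H.G1_nonneg; have hG2 := H.G2_nonneg; have hA := (lt_of_lt_of_le one_pos H.hA); have hr := H.hr
  have hl := H.lam3_nonneg; have hba := sub_pos.2 H.hαβ
  have hπ := Real.pi_pos
  have hj0 : 0 < j := by linarith
  -- each term `c/(2πj)^k ≤ (c/(2π)^k)/j²` for `k ≥ 2`
  have hk : ∀ (c : ℝ) (k : ℕ), 0 ≤ c → 2 ≤ k → c / (2 * π * j) ^ k ≤ c / (2 * π) ^ k / j ^ 2 := by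
    intro c k hc hk2
    rw [mul_pow, div_div]
    refine div_le_div_of_nonneg_left hc (by positivity) ?_
    refine mul_le_mul_of_nonneg_left ?_ (by positivity)
    calc j ^ 2 ≤ j ^ k := pow_le_pow_right₀ hj hk2
      _ = j ^ k := rfl
  unfold bTail
  have t1 := hk G₁ 2 hG1 le_rfl
  have t2 := hk (G * (2 * π * A * r)) 3 (by positivity) (by norm_num)
  have t3 := hk G₂ 2 hG2 le_rfl
  have t4 := hk (3 * G₁ * (2 * π * A * r)) 3 (by positivity) (by norm_num)
  have t5 := hk (G * (2 * π * lam3)) 3 (by positivity) (by norm_num)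
  have t6 := hk (3 * G * (2 * π * A * r) ^ 2) 4 (by positivity) (by norm_num)
  have hrhs : (2 * (G₁ / (2 * π) ^ 2 + G * (2 * π * A * r) / (2 * π) ^ 3)
      + (β - α) * (G₂ / (2 * π) ^ 2 + 3 * G₁ * (2 * π * A * r) / (2 * π) ^ 3 + G * (2 * π * lam3) / (2 * π) ^ 3
        + 3 * G * (2 * π * A * r) ^ 2 / (2 * π) ^ 4)) / j ^ 2
      = 2 * (G₁ / (2 * π) ^ 2 / j ^ 2 + G * (2 * π * A * r) / (2 * π) ^ 3 / j ^ 2)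
        + (β - α) * (G₂ / (2 * π) ^ 2 / j ^ 2 + 3 * G₁ * (2 * π * A * r) / (2 * π) ^ 3 / j ^ 2
          + G * (2 * π * lam3) / (2 * π) ^ 3 / j ^ 2 + 3 * G * (2 * π * A * r) ^ 2 / (2 * π) ^ 4 / j ^ 2) := by
    ring
  rw [hrhs]
  exact add_le_add (mul_le_mul_of_nonneg_left (add_le_add t1 t2) (by norm_num))
    (mul_le_mul_of_nonneg_left (add_le_add (add_le_add (add_le_add t3 t4) t5) t6) hba.le)

/-- **A far frequency**: if `|p'(x) - ν| ≥ j ≥ 1` on `[α, β]` then `‖I(ν)‖ ≤ T(2π)/j²`.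
[cite: GrahamKolesnik1991, Lemma 3.1] -/
theorem far_bound {ν j : ℝ} (hj : 1 ≤ j) (hfar : ∀ x ∈ Icc α β, j ≤ |p' x - ν|) :
    ‖∫ x in α..β, (g x : ℂ) * e (p x - ν * x)‖ ≤ bTail α β r A lam3 G G₁ G₂ (2 * π) / j ^ 2 := by
  have hπ := Real.pi_pos
  have hr := H.hr
  have hA := (lt_of_lt_of_le one_pos H.hA)
  simp only [summand_eq_exp g p]
  have key := norm_integral_amp_le_of_deriv_ge (P := fun x => 2 * π * (p x - ν * x)) (P' := fun x => 2 * π * (p' x - ν))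
    (P'' := fun x => 2 * π * p'' x) (P''' := fun x => 2 * π * p''' x) (g := g) (g' := g') (g'' := g'')
    (α := α) (β := β) (D := 2 * π * j) (B₂ := 2 * π * A * r) (B₃ := 2 * π * lam3) (G := G) (G₁ := G₁) (G₂ := G₂)
    H.hαβ' (by positivity) (by positivity) (by have := H.lam3_nonneg; positivity) H.G_nonneg H.G1_nonneg H.G2_nonneg
    (fun x hx => H.hasDerivAt_P ν hx) (fun x hx => H.hasDerivAt_P' ν hx) (fun x hx => H.hasDerivAt_P'' hx)
    (continuousOn_const.mul H.hp'''c)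
    (fun x hx => by
      rw [abs_mul, abs_of_pos (by positivity : (0:ℝ) < 2 * π)]
      exact mul_le_mul_of_nonneg_left (hfar x hx) (by positivity))
    (fun x hx => by
      rw [abs_of_pos (by have := (H.P''_bounds hx).1; nlinarith)]
      have := (H.P''_bounds hx).2; linarith)
    (fun x hx => H.P'''_bound hx) H.hg H.hg' H.hg''c H.hGb H.hG1b H.hG2b H.gα H.gβ
  refine key.trans ?_
  have := H.bTail_le_div hj
  unfold bTail at this ⊢
  exact this

/-! ### The Fourier transform of the summand -/

/-- `𝓕(g · e(p))(ν) = I(ν) = ∫_α^β g(x) e(p(x) - νx) dx`. [folklore] -/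
theorem fourier_summand_eq (ν : ℝ) :
    𝓕 (fun x => (g x : ℂ) * e (p x)) ν = ∫ x in α..β, (g x : ℂ) * e (p x - ν * x) := by
  rw [Real.fourier_real_eq_integral_exp_smul]
  have hint : ∀ v : ℝ, Complex.exp (((-2 * π * v * ν : ℝ) : ℂ) * I) • ((g v : ℂ) * e (p v))
      = (g v : ℂ) * e (p v - ν * v) := by
    intro v
    have hk : Complex.exp (((-2 * π * v * ν : ℝ) : ℂ) * I) = e (-(v * ν)) := by
      unfold e; congr 1; push_cast; ring
    rw [hk, smul_eq_mul, show p v - ν * v = p v + -(v * ν) by ring, e_add]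
    ring
  simp_rw [hint]
  have hzero : ∀ x, x ∉ Icc α β → (g x : ℂ) * e (p x - ν * x) = 0 := by
    intro x hx
    rw [H.hg0 x (fun h => hx (Ioo_subset_Icc_self h)), Complex.ofReal_zero, zero_mul]
  rw [← MeasureTheory.setIntegral_eq_integral_of_forall_compl_eq_zero (s := Icc α β) (fun x hx => hzero x hx),
    intervalIntegral.integral_of_le H.hαβ', MeasureTheory.integral_Icc_eq_integral_Ioc]

/-- The summand vanishes at the integers outside `[⌈α⌉, ⌊β⌋]`, so the series is a finite sum. [folklore] -/
theorem tsum_summand_eq_sum :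
    ∑' n : ℤ, (g n : ℂ) * e (p n) = ∑ n ∈ Finset.Icc ⌈α⌉ ⌊β⌋, (g n : ℂ) * e (p n) := by
  refine tsum_eq_sum fun n hn => ?_
  rw [Finset.mem_Icc, not_and_or, not_le, not_le] at hn
  have : (n : ℝ) ∉ Ioo α β := by
    rintro ⟨h1, h2⟩
    rcases hn with h | h
    · exact absurd (Int.ceil_le.2 h1.le) (not_le.2 h)
    · exact absurd (Int.le_floor.2 h2.le) (not_le.2 h)
  rw [H.hg0 _ this, Complex.ofReal_zero, zero_mul]

/-! ### The weighted `B`-process -/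

set_option maxHeartbeats 800000 in
/-- **The weighted van der Corput `B`-process.**  Under `WeightedBHyp` (phase `p` with `r ≤ p'' ≤ Ar`,
`|p'''| ≤ λ₃`; amplitude `g` with `|g| ≤ G`, `|g'| ≤ G₁`, `|g''| ≤ G₂`, vanishing outside `(α, β)`;
`g · e(p)` continuous), and for any choice of the stationary points `x_ν ∈ (α, β)`, `p'(x_ν) = ν`
(`p'(α) < ν < p'(β)`):
`‖∑_{n ∈ ℤ} g(n)e(p(n)) - 𝔣 ∑_{⌊p'(α)⌋ < ν < ⌈p'(β)⌉} g(x_ν) e(p(x_ν) - νx_ν) (2πp''(x_ν))^{-1/2}‖`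
`  ≤ (Ar(β - α) + 1) E₁ + 2 E₂ + 4 T(2π)` with `E₁, E₂, T` as in the module docstring.
[cite: GrahamKolesnik1991, Lemma 3.6] [cite: Titchmarsh1986, Theorem 4.9] -/
theorem weightedBProcess (x : ℤ → ℝ)
    (hx : ∀ ν : ℤ, p' α < ν → (ν : ℝ) < p' β → x ν ∈ Ioo α β ∧ p' (x ν) = ν) :
    ‖(∑' n : ℤ, (g n : ℂ) * e (p n))
        - 𝔣C * ∑ ν ∈ Finset.Ioo ⌊p' α⌋ ⌈p' β⌉,
            (g (x ν) : ℂ) * e (p (x ν) - ν * x ν) * ((Real.sqrt (2 * π * p'' (x ν)))⁻¹ : ℝ)‖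
      ≤ (A * r * (β - α) + 1) *
          (G * (2 * A ^ 3 * (2 * π * lam3 / (2 * π * r) ^ 2) * (2 + 2 * Real.log (1 + (β - α) * Real.sqrt (2 * π * r))))
            + G₁ / (2 * π * r) * (10 + 4 * A * Real.log (1 + (β - α) * Real.sqrt (2 * π * r))))
        + 2 * (G₁ / (2 * π * r) * (3 + (1 + A) * Real.log (1 + (β - α) * Real.sqrt (2 * π * r))))
        + 4 * bTail α β r A lam3 G G₁ G₂ (2 * π) := by
  have hπ := Real.pi_pos
  have hr := H.hr
  have hA := (lt_of_lt_of_le one_pos H.hA)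
  have hαβ := H.hαβ
  -- ### notation
  set L : ℝ := Real.log (1 + (β - α) * Real.sqrt (2 * π * r)) with hL
  have hL0 : 0 ≤ L := H.L_nonneg
  set E₁ : ℝ := G * (2 * A ^ 3 * (2 * π * lam3 / (2 * π * r) ^ 2) * (2 + 2 * L)) + G₁ / (2 * π * r) * (10 + 4 * A * L)
    with hE₁
  set E₂ : ℝ := G₁ / (2 * π * r) * (3 + (1 + A) * L) with hE₂
  set T₀ : ℝ := bTail α β r A lam3 G G₁ G₂ (2 * π) with hT₀
  have hE₁0 : 0 ≤ E₁ := by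
    have := H.G_nonneg; have := H.G1_nonneg; have := H.lam3_nonneg; positivity
  have hE₂0 : 0 ≤ E₂ := by have := H.G1_nonneg; positivity
  have hT₀0 : 0 ≤ T₀ := H.bTail_nonneg (by positivity)
  set f : ℝ → ℂ := fun y => (g y : ℂ) * e (p y) with hf
  set I : ℤ → ℂ := fun ν => ∫ y in α..β, (g y : ℂ) * e (p y - ν * y) with hI
  have hFI : ∀ ν : ℤ, 𝓕 f ν = I ν := fun ν => H.fourier_summand_eq ν
  set c₁ : ℤ := ⌊p' α⌋ with hc₁
  set c₂ : ℤ := ⌈p' β⌉ with hc₂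
  set N₁ : Finset ℤ := Finset.Ioo c₁ c₂ with hN₁
  have hc12 : c₁ < c₂ := by
    have h1 : (c₁ : ℝ) ≤ p' α := Int.floor_le _
    have h2 : p' β ≤ (c₂ : ℝ) := Int.le_ceil _
    have h3 := H.p'α_lt_p'β
    exact_mod_cast (h1.trans_lt (h3.trans_le h2))
  have hmemN₁ : ∀ ν : ℤ, ν ∈ N₁ ↔ p' α < ν ∧ (ν : ℝ) < p' β := by
    intro ν; rw [hN₁, Finset.mem_Ioo, hc₁, hc₂, Int.floor_lt, Int.lt_ceil]
  set Mt : ℤ → ℂ := fun ν => (g (x ν) : ℂ) * (𝔣C * e (p (x ν) - ν * x ν) * ((Real.sqrt (2 * π * p'' (x ν)))⁻¹ : ℝ))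
    with hMt
  set K : ℤ → ℂ := fun ν => if ν ∈ N₁ then Mt ν else 0 with hK
  set J : ℤ → ℂ := fun ν => I ν - K ν with hJ
  set m₁ : ℤ → ℝ := fun ν => if ν ∈ N₁ then E₁ else 0 with hm₁
  set m₂ : ℤ → ℝ := fun ν => if ν = c₁ ∨ ν = c₂ then E₂ else 0 with hm₂
  set m₃ : ℤ → ℝ := fun ν => if c₂ < ν then T₀ / (((ν - c₂ : ℤ) : ℝ)) ^ 2 else 0 with hm₃
  set m₄ : ℤ → ℝ := fun ν => if ν < c₁ then T₀ / (((c₁ - ν : ℤ) : ℝ)) ^ 2 else 0 with hm₄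
  have hm₁0 : ∀ ν, 0 ≤ m₁ ν := fun ν => by simp only [hm₁]; split_ifs <;> positivity
  have hm₂0 : ∀ ν, 0 ≤ m₂ ν := fun ν => by simp only [hm₂]; split_ifs <;> positivity
  have hm₃0 : ∀ ν, 0 ≤ m₃ ν := fun ν => by simp only [hm₃]; split_ifs <;> positivity
  have hm₄0 : ∀ ν, 0 ≤ m₄ ν := fun ν => by simp only [hm₄]; split_ifs <;> positivity
  set m : ℤ → ℝ := fun ν => m₁ ν + m₂ ν + m₃ ν + m₄ ν with hm
  -- ### pointwise bounds `‖J ν‖ ≤ m ν`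
  have hJm : ∀ ν : ℤ, ‖J ν‖ ≤ m ν := by
    intro ν
    have h10 := hm₁0 ν; have h20 := hm₂0 ν; have h30 := hm₃0 ν; have h40 := hm₄0 ν
    simp only [hm]
    by_cases h1 : ν ∈ N₁
    · -- a stationary frequency
      obtain ⟨hxν, hcrit⟩ := hx ν ((hmemN₁ ν).1 h1).1 ((hmemN₁ ν).1 h1).2
      have hb := H.stationary_bound hxν hcrit
      have hJeq : J ν = I ν - Mt ν := by simp only [hJ, hK, h1, if_true]
      have hm₁eq : m₁ ν = E₁ := by simp only [hm₁, h1, if_true]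
      rw [hJeq, hm₁eq]
      simp only [hI, hMt] at hb ⊢
      linarith
    · have hK0 : K ν = 0 := by simp only [hK, h1, if_false]
      have hJeq : J ν = I ν := by simp only [hJ, hK0, sub_zero]
      rw [hJeq]
      simp only [hI]
      by_cases h2 : ν = c₁ ∨ ν = c₂
      · have hm₂eq : m₂ ν = E₂ := by simp only [hm₂, h2, if_true]
        rw [hm₂eq]
        have hb : ‖∫ y in α..β, (g y : ℂ) * e (p y - ν * y)‖ ≤ E₂ := by
          rcases h2 with h | h
          · exact H.lower_near_bound (by rw [h, hc₁]; exact Int.floor_le _)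
          · exact H.upper_near_bound (by rw [h, hc₂]; exact Int.le_ceil _)
        linarith
      · rw [not_or] at h2
        rw [hN₁, Finset.mem_Ioo, not_and_or, not_lt, not_lt] at h1
        by_cases h3 : c₂ < ν
        · have hm₃eq : m₃ ν = T₀ / (((ν - c₂ : ℤ) : ℝ)) ^ 2 := by simp only [hm₃, h3, if_true]
          rw [hm₃eq]
          have hj : (1 : ℝ) ≤ ((ν - c₂ : ℤ) : ℝ) := by exact_mod_cast (show 1 ≤ ν - c₂ by omega)
          have h3' : (c₂ : ℝ) + 1 ≤ ν := by exact_mod_cast h3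
          have hb : ‖∫ y in α..β, (g y : ℂ) * e (p y - ν * y)‖ ≤ T₀ / (((ν - c₂ : ℤ) : ℝ)) ^ 2 := by
            refine H.far_bound hj fun y hy => ?_
            have hpy : p' y ≤ p' β := by
              have := (H.p'_incr hy H.βmem hy.2).1; nlinarith [hy.2]
            have hc₂' : p' β ≤ (c₂ : ℝ) := Int.le_ceil _
            rw [abs_sub_comm, abs_of_nonneg (by linarith)]
            push_cast; linarith
          linarith
        · have hlt : ν < c₁ := by
            rcases h1 with h | h
            · exact lt_of_le_of_ne h h2.1
            · exact absurd (lt_of_le_of_ne h (Ne.symm h2.2)) h3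
          have hm₄eq : m₄ ν = T₀ / (((c₁ - ν : ℤ) : ℝ)) ^ 2 := by simp only [hm₄, hlt, if_true]
          rw [hm₄eq]
          have hj : (1 : ℝ) ≤ ((c₁ - ν : ℤ) : ℝ) := by exact_mod_cast (show 1 ≤ c₁ - ν by omega)
          have hlt' : (ν : ℝ) + 1 ≤ c₁ := by exact_mod_cast hlt
          have hb : ‖∫ y in α..β, (g y : ℂ) * e (p y - ν * y)‖ ≤ T₀ / (((c₁ - ν : ℤ) : ℝ)) ^ 2 := by
            refine H.far_bound hj fun y hy => ?_
            have hpy : p' α ≤ p' y := by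
              have := (H.p'_incr H.αmem hy hy.1).1; nlinarith [hy.1]
            have hc₁' : (c₁ : ℝ) ≤ p' α := Int.floor_le _
            rw [abs_of_nonneg (by linarith)]
            push_cast; linarith
          linarith
  -- ### partial sums of the majorant
  have hm0 : ∀ ν, 0 ≤ m ν := fun ν => (norm_nonneg _).trans (hJm ν)
  have hcardN₁ : (N₁.card : ℝ) ≤ A * r * (β - α) + 1 := by
    rw [hN₁, Int.card_Ioo]
    have h0 : 0 ≤ c₂ - c₁ - 1 := by omega
    have e1 : (((c₂ - c₁ - 1).toNat : ℕ) : ℝ) = ((c₂ - c₁ - 1 : ℤ) : ℝ) := by exact_mod_cast Int.toNat_of_nonneg h0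
    rw [e1]; push_cast
    have h1 : (c₁ : ℝ) > p' α - 1 := by have := Int.lt_floor_add_one (p' α); rw [← hc₁] at this; linarith
    have h2 : (c₂ : ℝ) < p' β + 1 := by have := Int.ceil_lt_add_one (p' β); rw [← hc₂] at this; exact this
    have h3 := (H.p'_incr H.αmem H.βmem H.hαβ').2
    linarith
  have hsum_m : ∀ u : Finset ℤ, ∑ ν ∈ u, m ν ≤ (A * r * (β - α) + 1) * E₁ + 2 * E₂ + 4 * T₀ := by
    intro u
    -- piece 1
    have hp1 : ∑ ν ∈ u, m₁ ν ≤ (A * r * (β - α) + 1) * E₁ := by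
      rw [hm₁, ← Finset.sum_filter, Finset.sum_const, nsmul_eq_mul]
      have hcard : ((u.filter (fun ν => ν ∈ N₁)).card : ℝ) ≤ N₁.card := by
        exact_mod_cast Finset.card_le_card (fun ν hν => (Finset.mem_filter.1 hν).2)
      nlinarith [hcard, hcardN₁, hE₁0]
    -- piece 2
    have hp2 : ∑ ν ∈ u, m₂ ν ≤ 2 * E₂ := by
      rw [hm₂, ← Finset.sum_filter, Finset.sum_const, nsmul_eq_mul]
      have hcard : ((u.filter (fun ν => ν = c₁ ∨ ν = c₂)).card : ℝ) ≤ 2 := by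
        have : u.filter (fun ν => ν = c₁ ∨ ν = c₂) ⊆ {c₁, c₂} := by
          intro ν hν; rw [Finset.mem_filter] at hν; simp [hν.2]
        calc ((u.filter (fun ν => ν = c₁ ∨ ν = c₂)).card : ℝ) ≤ (({c₁, c₂} : Finset ℤ).card : ℝ) := by
              exact_mod_cast Finset.card_le_card this
          _ ≤ 2 := by exact_mod_cast Finset.card_le_two
      nlinarith [hcard, hE₂0]
    -- piece 3: reindex by `i = ν - c₂ ≥ 1` and use `∑ i⁻² ≤ 2`
    have hinvsq : ∀ (v : Finset ℤ) (c : ℤ), (∀ ν ∈ v, c < ν) →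
        ∑ ν ∈ v, T₀ / (((ν - c : ℤ) : ℝ)) ^ 2 ≤ 2 * T₀ := by
      intro v c hv
      set φi : ℤ → ℕ := fun ν => (ν - c).toNat with hφi
      have hinj : Set.InjOn φi v := by
        intro a ha b hb hab
        have ha' := hv a ha; have hb' := hv b hb
        simp only [hφi] at hab
        have : ((a - c).toNat : ℤ) = (b - c).toNat := by exact_mod_cast hab
        rw [Int.toNat_of_nonneg (by omega), Int.toNat_of_nonneg (by omega)] at this
        omega
      have hcast : ∀ ν ∈ v, T₀ / (((ν - c : ℤ) : ℝ)) ^ 2 = T₀ * (((φi ν : ℕ) : ℝ) ^ 2)⁻¹ := by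
        intro ν hν
        have h0 : 0 ≤ ν - c := by have := hv ν hν; omega
        have : ((φi ν : ℕ) : ℝ) = ((ν - c : ℤ) : ℝ) := by
          simp only [hφi]; exact_mod_cast Int.toNat_of_nonneg h0
        rw [this, div_eq_mul_inv]
      rw [Finset.sum_congr rfl hcast, ← Finset.mul_sum,
        ← Finset.sum_image (f := fun i : ℕ => (((i : ℕ) : ℝ) ^ 2)⁻¹) hinj]
      set img := v.image φi with himg
      set Kmax : ℕ := img.sup id with hKmax
      have hsub : img ⊆ Finset.Ioo 0 (Kmax + 1) := by
        intro i hi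
        rw [Finset.mem_Ioo]
        constructor
        · rw [himg, Finset.mem_image] at hi
          obtain ⟨ν, hν, rfl⟩ := hi
          have := hv ν hν
          simp only [hφi]
          omega
        · have : i ≤ Kmax := by rw [hKmax]; exact Finset.le_sup (f := id) hi
          omega
      have hle : ∑ i ∈ img, (((i : ℕ) : ℝ) ^ 2)⁻¹ ≤ ∑ i ∈ Finset.Ioo 0 (Kmax + 1), (((i : ℕ) : ℝ) ^ 2)⁻¹ :=
        Finset.sum_le_sum_of_subset_of_nonneg hsub fun _ _ _ => by positivity
      have h2 : ∑ i ∈ Finset.Ioo 0 (Kmax + 1), (((i : ℕ) : ℝ) ^ 2)⁻¹ ≤ 2 := by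
        have := sum_Ioo_inv_sq_le (α := ℝ) 0 (Kmax + 1)
        norm_num at this
        exact this
      calc T₀ * ∑ i ∈ img, (((i : ℕ) : ℝ) ^ 2)⁻¹ ≤ T₀ * 2 := by
            exact mul_le_mul_of_nonneg_left (hle.trans h2) hT₀0
        _ = 2 * T₀ := by ring
    have hp3 : ∑ ν ∈ u, m₃ ν ≤ 2 * T₀ := by
      rw [hm₃, ← Finset.sum_filter]
      exact hinvsq _ c₂ fun ν hν => (Finset.mem_filter.1 hν).2
    -- piece 4: reflect `ν ↦ -ν`
    have hp4 : ∑ ν ∈ u, m₄ ν ≤ 2 * T₀ := by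
      rw [hm₄, ← Finset.sum_filter]
      set v := u.filter (fun ν => ν < c₁) with hv
      have hneg : ∑ ν ∈ v, T₀ / (((c₁ - ν : ℤ) : ℝ)) ^ 2 = ∑ μ ∈ v.image (fun ν => -ν), T₀ / (((μ - (-c₁) : ℤ) : ℝ)) ^ 2 := by
        rw [Finset.sum_image (fun a _ b _ h => neg_injective h)]
        refine Finset.sum_congr rfl fun ν _ => ?_
        congr 2; push_cast; ring
      rw [hneg]
      exact hinvsq _ (-c₁) fun μ hμ => by
        rw [Finset.mem_image] at hμ
        obtain ⟨ν, hν, rfl⟩ := hμ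
        have := (Finset.mem_filter.1 hν).2
        omega
    calc ∑ ν ∈ u, m ν = ∑ ν ∈ u, m₁ ν + ∑ ν ∈ u, m₂ ν + ∑ ν ∈ u, m₃ ν + ∑ ν ∈ u, m₄ ν := by
          simp only [hm]
          rw [Finset.sum_add_distrib, Finset.sum_add_distrib, Finset.sum_add_distrib]
      _ ≤ (A * r * (β - α) + 1) * E₁ + 2 * E₂ + 2 * T₀ + 2 * T₀ := by linarith
      _ = (A * r * (β - α) + 1) * E₁ + 2 * E₂ + 4 * T₀ := by ring
  -- ### summability
  have hJnsum : Summable fun ν => ‖J ν‖ :=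
    summable_of_sum_le (fun ν => norm_nonneg _) fun u =>
      (Finset.sum_le_sum fun ν _ => hJm ν).trans (hsum_m u)
  have hJs : Summable J := hJnsum.of_norm
  have hKs : Summable K := summable_of_ne_finset_zero (s := N₁) fun ν hν => by simp only [hK, hν, if_false]
  have hIs : Summable I := by
    have := hJs.add hKs
    refine this.congr fun ν => ?_
    simp only [hJ, sub_add_cancel]
  have hFs : Summable fun ν : ℤ => 𝓕 f ν := hIs.congr fun ν => (hFI ν).symm
  -- ### Poisson summation
  have hbigO : f =O[cocompact ℝ] fun y : ℝ => |y| ^ (-(2 : ℝ)) := by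
    have hzero : ∀ y, y ∉ Icc α β → f y = 0 := fun y hy => by
      simp only [hf]; rw [H.hg0 y (fun h => hy (Ioo_subset_Icc_self h)), Complex.ofReal_zero, zero_mul]
    have hev : f =ᶠ[cocompact ℝ] (fun _ => (0 : ℂ)) := by
      filter_upwards [isCompact_Icc.compl_mem_cocompact] with y hy using hzero y hy
    exact (Asymptotics.isBigO_zero (fun y : ℝ => |y| ^ (-(2 : ℝ))) (cocompact ℝ)).congr' hev.symm EventuallyEq.rfl
  have hP := Real.tsum_eq_tsum_fourier_of_rpow_decay_of_summable H.hcont one_lt_two hbigO hFs 0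
  simp only [zero_add, QuotientAddGroup.mk_zero, fourier_eval_zero, mul_one] at hP
  -- `hP : ∑' n, f n = ∑' ν, 𝓕 f ν`
  have hP' : ∑' n : ℤ, f n = ∑' ν : ℤ, I ν := by
    rw [hP]; exact tsum_congr hFI
  -- ### assembly
  have hIJK : ∑' ν : ℤ, I ν = ∑' ν : ℤ, J ν + ∑ ν ∈ N₁, Mt ν := by
    have hMK : ∑ ν ∈ N₁, Mt ν = ∑ ν ∈ N₁, K ν :=
      Finset.sum_congr rfl fun ν hν => by simp only [hK, hν, if_true]
    have hKt : ∑' ν : ℤ, K ν = ∑ ν ∈ N₁, K ν := tsum_eq_sum fun ν hν => by simp only [hK, hν, if_false]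
    rw [hMK, ← hKt, ← (hJs.hasSum.add hKs.hasSum).tsum_eq]
    refine tsum_congr fun ν => ?_
    simp only [hJ, sub_add_cancel]
  have hKsum : ∑ ν ∈ N₁, Mt ν
      = 𝔣C * ∑ ν ∈ N₁, (g (x ν) : ℂ) * e (p (x ν) - ν * x ν) * ((Real.sqrt (2 * π * p'' (x ν)))⁻¹ : ℝ) := by
    rw [Finset.mul_sum]
    refine Finset.sum_congr rfl fun ν hν => ?_
    simp only [hMt]
    ring
  have hfin : ‖∑' ν : ℤ, J ν‖ ≤ (A * r * (β - α) + 1) * E₁ + 2 * E₂ + 4 * T₀ := by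
    refine (norm_tsum_le_tsum_norm hJnsum).trans ?_
    exact Real.tsum_le_of_sum_le (fun ν => norm_nonneg _) fun u =>
      (Finset.sum_le_sum fun ν _ => hJm ν).trans (hsum_m u)
  have hfun : (fun n : ℤ => (g n : ℂ) * e (p n)) = fun n : ℤ => f n := rfl
  rw [hfun, hP', hIJK, hKsum, add_sub_cancel_right]
  exact hfin


end WeightedBHyp

end VdC
end Literature.NumberTheory.LFunctions

end
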